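import Summits.ResolutionOfSingularities.ResolutionOfSingularities.Theorems.EquisingularLiftEquisingularLiftNatDeltaCentre
import Summits.ResolutionOfSingularities.ResolutionOfSingularities.Theorems.EquisingularLiftEquisingularLiftNatPlaneCurveSingular
import Mathlib
import HarnessLib

/-!
# [OURS · L1 W4.5(b)] Δ-centre toolkit D1 (iii) `DeltaRegularGeneric` for the crux `EquisingularLiftNat`
# (EL♮, stmt-ResolutionOfSingularities-20038), line `sections`, research stub `stub_elnat_three`

NOT a statement of any manuscript. Helper file of the chain res-L1-w45b (CRUX-PLAN v3 §4, CHAIN v6.1 §3;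
continuation of `…Theorems.EquisingularLiftEquisingularLiftNatDeltaCentre`, p497957): the third typed
signature candidate `DeltaRegularGeneric` of the planner's `L/w45b/EL-NATURAL/DeltaCentreSignatures.lean`
(sha16 `f3e4d5718baef2ab`, audited TRUE as typed by res-L1-w45b-tri-1) is proved here BY SIGNATURE
(`deltaRegularGeneric`, body verbatim; checked: `example : DeltaCentreDraft.DeltaRegularGeneric :=
deltaRegularGeneric` elaborates against a copy of the planner's defs).

**Statement.** `O` a DVR with uniformizer `ϖ`, `k = O/ϖ`, `A = O[x, y]`, `B = k[x, y]`, `g ∈ A` with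
reduction `ḡ ≠ 0` squarefree (the plane curve `D = V(ḡ)` is reduced). Then for all units `u ∈ O` whose
residue avoids a FINITE set `S ⊂ k`, the Δ-curve `A/(g + uϖ)` is regular at every prime containing `ϖ`
(= along its special fibre `D`).

**Proof.** A prime `Q̄ ∋ ϖ` of `A/(g + uϖ)` is `Q/(g + uϖ)` for a prime `Q ⊇ (g, ϖ)` of `A`, i.e.
`Q = red⁻¹(𝔮)` for a prime `𝔮 ∋ ḡ` of `B` — a set of primes INDEPENDENT of `u`. `A_Q` is a regular
local ring (`A` is regular: Mathlib), so `(A/(g + uϖ))_{Q̄} = A_Q/(g + uϖ)` is regular as soon as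
`g + uϖ ∉ 𝔪_Q²` (tree `isRegularLocalRing_localization_quotient_of_notMem_sq`, Matsumura 14.2).
* If `ḡ ∉ 𝔪_𝔮²` (in `B_𝔮`), then `g + uϖ ∉ 𝔪_Q²` for EVERY `u`: the local homomorphism `A_Q → B_𝔮`
  maps `𝔪_Q²` into `𝔪_𝔮²` and `g + uϖ` to `ḡ` (`notMem_sq_of_map_notMem_sq`).
* If `ḡ ∈ 𝔪_𝔮²`, at most ONE residue class `ū` has `g + uϖ ∈ 𝔪_Q²`: two such `u, u'` with
  `ū ≠ ū'` give `(u - u')ϖ ∈ 𝔪_Q²` with `u - u'` a unit, i.e. `ϖ ∈ 𝔪_Q²` — impossible, because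
  `A_Q/(ϖ) ≅ B_𝔮` is regular (`isRegularLocalRing_localization_quotient_C`) and a regular local ring
  modulo a non-zero-divisor `x ∈ 𝔪` is regular only if `x ∉ 𝔪²` (`not_mem_sq_of_isRegularLocalRing_quotient`).
* The primes `𝔮 ∋ ḡ` with `ḡ ∈ 𝔪_𝔮²` are finitely many (`finite_setOf_mem_sq`, previous file).
The excluded set `S` is the union over these finitely many `𝔮` of the (subsingleton) sets of bad residues.
-/

set_option linter.dupNamespace false -- mandated namespace `Summit.<Summit>.<Problem>` of this single-conjunct summit
set_option linter.overlappingInstances false -- the audited signature carries both [IsDomain O] and [IsDiscreteValuationRing O] (Mathlib's class takes the former as a parameter)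

namespace Summit.ResolutionOfSingularities.ResolutionOfSingularities.Cruxes.EquisingularLiftNat.Sections

open MvPolynomial IsLocalRing Literature.AlgebraicGeometry.Resolution
open Summit.ResolutionOfSingularities.ResolutionOfSingularities.Theorems

/-! ## The ambient local rings `O[x, y]_Q` modulo `ϖ` -/

section Ambient

variable {O : Type} [CommRing O] [IsDomain O] [IsDiscreteValuationRing O] {ϖ : O}

/-- For a prime `Q ∋ ϖ` of `A = O[x, y]` (`O` a DVR with uniformizer `ϖ`): `A_Q/(ϖ) ≅ (k[x, y])_𝔮` is a
regular local ring (`k = O/ϖ`; localisation commutes with quotients, tree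
`isRegularLocalRing_localization_quotient_iff`; `k[x, y]` is regular, Mathlib). [folklore]
[OURS · L1 W4.5b] -/
theorem isRegularLocalRing_localization_quotient_C (hϖ : Irreducible ϖ)
    (Q : Ideal (MvPolynomial (Fin 2) O)) [Q.IsPrime] (hQ : (C ϖ : MvPolynomial (Fin 2) O) ∈ Q) :
    IsRegularLocalRing (Localization.AtPrime Q ⧸
      Ideal.span {algebraMap (MvPolynomial (Fin 2) O) (Localization.AtPrime Q) (C ϖ)}) := by
  set A := MvPolynomial (Fin 2) O with hA
  set J : Ideal A := (Ideal.span {ϖ}).map (C : O →+* A) with hJdef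
  have hJ : J = Ideal.span {(C ϖ : A)} := by rw [hJdef, Ideal.map_span, Set.image_singleton]
  have hJQ : J ≤ Q := by rw [hJ, Ideal.span_singleton_le_iff_mem]; exact hQ
  obtain ⟨hprime, hcomap⟩ := isPrime_map_mk_and_comap_eq J Q hJQ
  haveI := hprime
  haveI hmax : (Ideal.span {ϖ}).IsMaximal := PrincipalIdealRing.isMaximal_of_irreducible hϖ
  letI : Field (O ⧸ Ideal.span {ϖ}) := Ideal.Quotient.field _
  haveI : IsRegularRing (A ⧸ J) :=
    IsRegularRing.of_ringEquiv
      (MvPolynomial.quotientEquivQuotientMvPolynomial (σ := Fin 2) (Ideal.span {ϖ})).toRingEquiv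
  have h1 : IsRegularLocalRing (Localization.AtPrime (Q.map (Ideal.Quotient.mk J))) :=
    IsRegularRing.isRegularLocalRing_localization _
  have h2 := (isRegularLocalRing_localization_quotient_iff J Q (Q.map (Ideal.Quotient.mk J))
    hcomap).mp h1
  have hJ' : J.map (algebraMap A (Localization.AtPrime Q)) =
      Ideal.span {algebraMap A (Localization.AtPrime Q) (C ϖ)} := by
    rw [hJ, Ideal.map_span, Set.image_singleton]
  rw [hJ'] at h2
  exact h2

/-- For a prime `Q ∋ ϖ` of `A = O[x, y]`: `ϖ ∉ 𝔪_Q²` in the regular local ring `A_Q` (its quotient by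
`ϖ` is regular, `isRegularLocalRing_localization_quotient_C`, so `not_mem_sq_of_isRegularLocalRing_quotient`
applies). [folklore] [OURS · L1 W4.5b] -/
theorem C_varpi_notMem_sq (hϖ : Irreducible ϖ)
    (Q : Ideal (MvPolynomial (Fin 2) O)) [Q.IsPrime] (hQ : (C ϖ : MvPolynomial (Fin 2) O) ∈ Q) :
    algebraMap (MvPolynomial (Fin 2) O) (Localization.AtPrime Q) (C ϖ) ∉
      maximalIdeal (Localization.AtPrime Q) ^ 2 := by
  set A := MvPolynomial (Fin 2) O with hA
  set L := Localization.AtPrime Q with hL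
  haveI : IsRegularLocalRing L := IsRegularRing.isRegularLocalRing_localization Q
  have hmem : algebraMap A L (C ϖ) ∈ maximalIdeal L := by
    rw [← Localization.AtPrime.map_eq_maximalIdeal]
    exact Ideal.mem_map_of_mem _ hQ
  have hinj : Function.Injective (algebraMap A L) :=
    IsLocalization.injective L Q.primeCompl_le_nonZeroDivisors
  have hne : algebraMap A L (C ϖ) ≠ 0 := by
    rw [Ne, ← map_zero (algebraMap A L), hinj.eq_iff, MvPolynomial.C_eq_zero]
    exact hϖ.ne_zero
  have hreg : IsSMulRegular L (algebraMap A L (C ϖ)) :=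
    (IsRegular.of_ne_zero hne).left.isSMulRegular
  exact not_mem_sq_of_isRegularLocalRing_quotient hmem hreg
    (isRegularLocalRing_localization_quotient_C hϖ Q hQ)

end Ambient

/-! ## D1 (iii): generic regularity of the Δ-curve along its special fibre -/

/-- **D1 (iii) `DeltaRegularGeneric`, by signature** (planner's `DeltaCentreSignatures.lean`
f3e4d5718baef2ab, body verbatim): for a DVR `O` with uniformizer `ϖ` and `g ∈ O[x, y]` whose reduction
`ḡ` is non-zero and squarefree, there is a finite set `S` of residues such that for every unit `u` with
`ū ∉ S` the Δ-curve `O[x, y]/(g + uϖ)` is a regular local ring at every prime containing `ϖ`.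
See the module docstring for the proof. [OURS · L1 W4.5b] helper toward `stub_elnat_three`; NOT a
statement of the manuscript. -/
theorem deltaRegularGeneric :
    ∀ (O : Type) [CommRing O] [IsDomain O] [IsDiscreteValuationRing O] (ϖ : O), Irreducible ϖ →
    ∀ (g : MvPolynomial (Fin 2) O),
      MvPolynomial.map (Ideal.Quotient.mk (Ideal.span {ϖ})) g ≠ 0 →
      Squarefree (MvPolynomial.map (Ideal.Quotient.mk (Ideal.span {ϖ})) g) →
      ∃ S : Finset (O ⧸ Ideal.span {ϖ}), ∀ u : Oˣ, Ideal.Quotient.mk (Ideal.span {ϖ}) (u : O) ∉ S →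
        letI A := MvPolynomial (Fin 2) O
        letI I : Ideal A := Ideal.span {g + C ((u : O) * ϖ)}
        ∀ (Q : Ideal (A ⧸ I)) [Q.IsPrime], Ideal.Quotient.mk I (C ϖ : A) ∈ Q →
          IsRegularLocalRing (Localization.AtPrime Q) := by
  intro O _ _ _ ϖ hϖ g hg0 hsq
  classical
  haveI hmax : (Ideal.span {ϖ}).IsMaximal := PrincipalIdealRing.isMaximal_of_irreducible hϖ
  -- the reduction map `red : O[x, y] → k[x, y]`, `k = O/ϖ`
  have hredC : ∀ c : O, MvPolynomial.map (σ := Fin 2) (Ideal.Quotient.mk (Ideal.span {ϖ}))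
      (C (c * ϖ)) = 0 := fun c => by
    rw [map_C, Ideal.Quotient.eq_zero_iff_mem.mpr
      (Ideal.mul_mem_left _ c (Ideal.mem_span_singleton_self ϖ)), C_0]
  have hredG : ∀ c : O, MvPolynomial.map (σ := Fin 2) (Ideal.Quotient.mk (Ideal.span {ϖ}))
      (g + C (c * ϖ)) = MvPolynomial.map (Ideal.Quotient.mk (Ideal.span {ϖ})) g := fun c => by
    rw [map_add, hredC, add_zero]
  have hker : RingHom.ker (MvPolynomial.map (σ := Fin 2) (Ideal.Quotient.mk (Ideal.span {ϖ}))) =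
      Ideal.span {(C ϖ : MvPolynomial (Fin 2) O)} := by
    rw [MvPolynomial.ker_map, Ideal.mk_ker, Ideal.map_span, Set.image_singleton]
  have hsurj : Function.Surjective
      (MvPolynomial.map (σ := Fin 2) (Ideal.Quotient.mk (Ideal.span {ϖ}))) :=
    MvPolynomial.map_surjective _ Ideal.Quotient.mk_surjective
  -- the finitely many bad primes `𝔮` of `k[x, y]` (`ḡ ∈ 𝔪_𝔮²`) …
  have hTfin := @finite_setOf_mem_sq (O ⧸ Ideal.span {ϖ}) (Ideal.Quotient.field _) _ hg0 hsq
  -- … and, for each prime `𝔮` of `k[x, y]`, the (subsingleton) set of bad residues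
  have hEsub : ∀ 𝔮 : PrimeSpectrum (MvPolynomial (Fin 2) (O ⧸ Ideal.span {ϖ})),
      {r : O ⧸ Ideal.span {ϖ} | ∃ c : O, Ideal.Quotient.mk (Ideal.span {ϖ}) c = r ∧
        algebraMap (MvPolynomial (Fin 2) O) (Localization.AtPrime
          (𝔮.asIdeal.comap (MvPolynomial.map (σ := Fin 2) (Ideal.Quotient.mk (Ideal.span {ϖ})))))
          (g + C (c * ϖ)) ∈ maximalIdeal _ ^ 2}.Subsingleton := by
    intro 𝔮 r₁ hr₁ r₂ hr₂
    obtain ⟨c₁, rfl, h₁⟩ := hr₁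
    obtain ⟨c₂, rfl, h₂⟩ := hr₂
    by_contra hne
    have hPϖ : (C ϖ : MvPolynomial (Fin 2) O) ∈
        𝔮.asIdeal.comap (MvPolynomial.map (σ := Fin 2) (Ideal.Quotient.mk (Ideal.span {ϖ}))) := by
      have h0 := hredC 1
      rw [one_mul] at h0
      rw [Ideal.mem_comap, h0]
      exact Ideal.zero_mem _
    -- `(c₁ - c₂) ϖ ∈ 𝔪²` with `c₁ - c₂` a unit, hence `ϖ ∈ 𝔪²`: impossible
    have hdiff := sub_mem h₁ h₂
    rw [← map_sub, show g + C (c₁ * ϖ) - (g + C (c₂ * ϖ)) = C (c₁ - c₂) * C ϖ by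
      simp only [map_mul, map_sub]; ring] at hdiff
    have hunit : IsUnit (c₁ - c₂) := by
      by_contra hnu
      apply hne
      have hmem : c₁ - c₂ ∈ maximalIdeal O := (IsLocalRing.mem_maximalIdeal _).mpr hnu
      rw [hϖ.maximalIdeal_eq] at hmem
      exact (Ideal.Quotient.eq).mpr hmem
    obtain ⟨v, hv⟩ := hunit
    have h3 := Ideal.mul_mem_left _ (algebraMap (MvPolynomial (Fin 2) O) _ (C ((v⁻¹ : Oˣ) : O))) hdiff
    rw [← map_mul, ← mul_assoc, ← C_mul, ← hv, Units.inv_mul, C_1, one_mul] at h3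
    exact C_varpi_notMem_sq hϖ _ hPϖ h3
  have hSfin := hTfin.biUnion fun 𝔮 _ => (hEsub 𝔮).finite
  refine ⟨hSfin.toFinset, fun u hu => ?_⟩
  intro Q _ hQϖ
  -- the prime `P = Q ∩ A ⊇ (g + uϖ, ϖ)` of `A` and its image `𝔮 ∋ ḡ` in `k[x, y]`
  have hGP : g + C ((u : O) * ϖ) ∈ Q.comap (Ideal.Quotient.mk (Ideal.span {g + C ((u : O) * ϖ)})) := by
    rw [Ideal.mem_comap, Ideal.Quotient.eq_zero_iff_mem.mpr (Ideal.mem_span_singleton_self _)]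
    exact Q.zero_mem
  have hϖP : (C ϖ : MvPolynomial (Fin 2) O) ∈ Q.comap (Ideal.Quotient.mk (Ideal.span {g + C ((u : O) * ϖ)})) := by
    rw [Ideal.mem_comap]; exact hQϖ
  have hgP : g ∈ Q.comap (Ideal.Quotient.mk (Ideal.span {g + C ((u : O) * ϖ)})) := by
    have h := sub_mem hGP (Ideal.mul_mem_left _ (C (u : O)) hϖP)
    have e : g + C ((u : O) * ϖ) - C (u : O) * C ϖ = g := by rw [C_mul]; ring
    rwa [e] at h
  have hkerP : RingHom.ker (MvPolynomial.map (σ := Fin 2) (Ideal.Quotient.mk (Ideal.span {ϖ}))) ≤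
      Q.comap (Ideal.Quotient.mk (Ideal.span {g + C ((u : O) * ϖ)})) := by
    rw [hker, Ideal.span_singleton_le_iff_mem]; exact hϖP
  haveI h𝔮prime : ((Q.comap (Ideal.Quotient.mk (Ideal.span {g + C ((u : O) * ϖ)}))).map
      (MvPolynomial.map (σ := Fin 2) (Ideal.Quotient.mk (Ideal.span {ϖ})))).IsPrime :=
    Ideal.map_isPrime_of_surjective hsurj hkerP
  let 𝔮 : PrimeSpectrum (MvPolynomial (Fin 2) (O ⧸ Ideal.span {ϖ})) :=
    ⟨(Q.comap (Ideal.Quotient.mk (Ideal.span {g + C ((u : O) * ϖ)}))).map (MvPolynomial.map (Ideal.Quotient.mk (Ideal.span {ϖ}))),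
      h𝔮prime⟩
  have hcomapq : 𝔮.asIdeal.comap (MvPolynomial.map (σ := Fin 2) (Ideal.Quotient.mk (Ideal.span {ϖ}))) =
      Q.comap (Ideal.Quotient.mk (Ideal.span {g + C ((u : O) * ϖ)})) := by
    change ((Q.comap (Ideal.Quotient.mk (Ideal.span {g + C ((u : O) * ϖ)}))).map _).comap _ = _
    rw [Ideal.comap_map_of_surjective _ hsurj, ← RingHom.ker_eq_comap_bot, sup_eq_left.mpr hkerP]
  have hgq : MvPolynomial.map (Ideal.Quotient.mk (Ideal.span {ϖ})) g ∈ 𝔮.asIdeal :=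
    Ideal.mem_map_of_mem _ hgP
  -- `A_P` is regular; conclude once `g + uϖ ∉ 𝔪_P²`
  haveI : IsRegularLocalRing (Localization.AtPrime (Q.comap (Ideal.Quotient.mk (Ideal.span {g + C ((u : O) * ϖ)})))) :=
    IsRegularRing.isRegularLocalRing_localization _
  refine isRegularLocalRing_localization_quotient_of_notMem_sq Q ?_
  by_cases hcase : algebraMap (MvPolynomial (Fin 2) (O ⧸ Ideal.span {ϖ})) (Localization.AtPrime 𝔮.asIdeal)
      (MvPolynomial.map (Ideal.Quotient.mk (Ideal.span {ϖ})) g) ∈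
        maximalIdeal (Localization.AtPrime 𝔮.asIdeal) ^ 2
  · -- bad prime: the residue of `u` would lie in the excluded set
    intro hG2
    apply hu
    rw [Set.Finite.mem_toFinset, Set.mem_iUnion₂]
    refine ⟨𝔮, ⟨hgq, hcase⟩, (u : O), rfl, ?_⟩
    exact (mem_sq_maximalIdeal_localization_iff_of_eq hcomapq.symm _).mp hG2
  · -- good prime: `g + uϖ ∉ 𝔪_P²` for every `u`
    refine notMem_sq_of_map_notMem_sq (MvPolynomial.map (σ := Fin 2) (Ideal.Quotient.mk (Ideal.span {ϖ})))
      𝔮.asIdeal (Q.comap (Ideal.Quotient.mk (Ideal.span {g + C ((u : O) * ϖ)}))) hcomapq.symm ?_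
    rw [hredG]
    exact hcase


/-- **A good unit exists** (corollary of `deltaRegularGeneric` for an INFINITE residue field, e.g. the
algebraically closed `k` of EL♮): for a DVR `O` with uniformizer `ϖ`, `O/ϖ` infinite, and `g ∈ O[x, y]` with
`ḡ ≠ 0` squarefree, there is a unit `u` such that the Δ-curve `O[x, y]/(g + uϖ)` is a regular local ring
at every prime containing `ϖ` (pick a residue outside the finite excluded set and outside `0`, lift it:
a lift of a non-zero residue is a unit). [OURS · L1 W4.5b] helper toward `stub_elnat_three`; NOT a
statement of the manuscript. -/
theorem exists_unit_deltaRegular (O : Type) [CommRing O] [IsDomain O] [IsDiscreteValuationRing O]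
    (ϖ : O) (hϖ : Irreducible ϖ) [Infinite (O ⧸ Ideal.span {ϖ})] (g : MvPolynomial (Fin 2) O)
    (hg0 : MvPolynomial.map (Ideal.Quotient.mk (Ideal.span {ϖ})) g ≠ 0)
    (hsq : Squarefree (MvPolynomial.map (Ideal.Quotient.mk (Ideal.span {ϖ})) g)) :
    ∃ u : Oˣ,
      letI A := MvPolynomial (Fin 2) O
      letI I : Ideal A := Ideal.span {g + C ((u : O) * ϖ)}
      ∀ (Q : Ideal (A ⧸ I)) [Q.IsPrime], Ideal.Quotient.mk I (C ϖ : A) ∈ Q →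
        IsRegularLocalRing (Localization.AtPrime Q) := by
  classical
  obtain ⟨S, hS⟩ := deltaRegularGeneric O ϖ hϖ g hg0 hsq
  -- a residue outside `S ∪ {0}`
  obtain ⟨r, hr⟩ := Infinite.exists_notMem_finset (insert (0 : O ⧸ Ideal.span {ϖ}) S)
  rw [Finset.mem_insert, not_or] at hr
  obtain ⟨c, rfl⟩ := Ideal.Quotient.mk_surjective r
  -- its lifts are units
  have hc : c ∉ maximalIdeal O := by
    rw [hϖ.maximalIdeal_eq, ← Ideal.Quotient.eq_zero_iff_mem]
    exact hr.1
  have hunit : IsUnit c := by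
    by_contra h
    exact hc ((IsLocalRing.mem_maximalIdeal c).mpr h)
  obtain ⟨u, rfl⟩ := hunit
  exact ⟨u, fun Q _ hQ => hS u hr.2 Q hQ⟩

end Summit.ResolutionOfSingularities.ResolutionOfSingularities.Cruxes.EquisingularLiftNat.Sections
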